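import Literature.NumberTheory.LFunctions.ZetaZerosShortIntervalsRH
import Literature.NumberTheory.LFunctions.PrimeDirichletPolynomialMoments
import HarnessLib

/-!
# Frequency of large deviations of the zero count in short intervals (Balazard–de Roton 2008, Props. 14, 17)

Topic `Literature/NumberTheory/LFunctions`. Everything in this file is PROVED (no definitions, no
named facts).

M. Balazard, A. de Roton, arXiv:0810.3587:

> **Proposition 14.** `T` grand, `(log log T)² ≤ V ≤ log T/log log T`, `η = 1/log V`,
> `k = ⌊V/(1+η)⌋`. Alors `k (log(k log log T) − 2 log(ηV)) ≤ −V log(V/log log T) + 2V log log V + V`.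
>
> **Proposition 17 (HR).** `T` grand, `0 < h ≤ √T`, `(log log T)² ≤ V ≤ log T/log log T`,
> `T ≤ t_1 < ⋯ < t_R ≤ 2T`, `t_{r+1} − t_r ≥ 1`, et `N(t_r+h) − N(t_r−h) − (h/π) log(t_r/2π) ≥ V`
> (`1 ≤ r ≤ R`). Alors `R ≪ T exp(−V log(V/log log T) + 2V log log V + O(V))`.

* `Literature.NumberTheory.LFunctions.DeviationFrequency.prop14` — Prop. 14, with `log log T`
  replaced by a real parameter `b` (`6 ≤ b`, `b² ≤ V`, and `V` large: `2 ≤ log V`, `(log V)² ≤ √V`).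
* `Literature.NumberTheory.LFunctions.card_deviations_le_of_RH` — Prop. 17 for `0 < h ≤ 1` (the
  case used in Prop. 20), with `O(V) = 8V`, and for `1`-spaced ordinates in the slightly larger
  window `[T − 1, 2T + 1]` (as needed in the proof of Prop. 20): under RH there is `T₀` such that
  for `T ≥ T₀` the number `R = #𝒯` of such ordinates satisfies
  `R ≤ T exp(−V log(V/log log T) + 2V log log V + 8V)`.

Proof of Prop. 17 (as printed): Prop. 15 (`ShortIntervalsRH.zetaZeroCount_short_interval_le_of_RH`)
with `Δ = (1+η) log T/(2πV)` makes the real Dirichlet polynomial `Σ_{p ≤ T^{(1+η)/V}} a(p) cos(t_r log p)`,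
`|a(p)| ≤ 4/√p`, at least `ηV/2` in modulus; raise to the power `2k`, sum over `r`, and apply
Prop. 13 (`sum_norm_primePoly_pow_le`) and Prop. 14.

## References

* [BalazardDeRoton2008] M. Balazard, A. de Roton, arXiv:0810.3587, Props. 14, 17.
  [cite: BalazardDeRoton2008, Prop. 17]
* K. Soundararajan, J. reine angew. Math. 631 (2009), proof of Prop. 4.
-/

noncomputable section

open Complex Filter Set Topology Finset Asymptotics
open scoped Real FourierTransform

namespace Literature.NumberTheory.LFunctions

open Literature.Analysis.Fourier ShortIntervalsRH

namespace DeviationFrequency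

/-- **Balazard–de Roton 2008, Prop. 14** (auxiliary computation), with `b` in place of `log log T`:
for `6 ≤ b`, `b² ≤ V`, `2 ≤ log V`, `(log V)² ≤ √V`, `η = 1/log V` and `k = ⌊V/(1+η)⌋`,
`k (log(k b) − 2 log(ηV)) ≤ −V log(V/b) + 2V log log V + V`, and `V(1 − η) ≤ k ≤ V`.
[cite: BalazardDeRoton2008, Prop. 14] -/
theorem prop14 {V b : ℝ} (hb : 6 ≤ b) (hbV : b ^ 2 ≤ V) (hlogV : 2 ≤ Real.log V)
    (hlogV2 : Real.log V ^ 2 ≤ Real.sqrt V) :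
    let η : ℝ := 1 / Real.log V
    let k : ℕ := ⌊V / (1 + η)⌋₊
    V * (1 - η) ≤ k ∧ (k : ℝ) ≤ V ∧
      (k : ℝ) * (Real.log (k * b) - 2 * Real.log (η * V)) ≤
        -V * Real.log (V / b) + 2 * V * Real.log (Real.log V) + V := by
  intro η k
  have hV36 : (36 : ℝ) ≤ V := by nlinarith
  have hV0 : 0 < V := by linarith
  have hb0 : 0 < b := by linarith
  have hη0 : 0 < η := by positivity
  have hη1 : η ≤ 1 / 2 := by
    show 1 / Real.log V ≤ 1 / 2
    rw [div_le_div_iff₀ (by linarith) (by norm_num)]; linarith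
  have hsqV : Real.sqrt V ≤ V / b * 1 := by
    rw [mul_one, le_div_iff₀ hb0]
    have hbs : b ≤ Real.sqrt V := by
      rw [Real.le_sqrt hb0.le hV0.le]; exact hbV
    calc Real.sqrt V * b ≤ Real.sqrt V * Real.sqrt V := by gcongr
      _ = V := Real.mul_self_sqrt hV0.le
  rw [mul_one] at hsqV
  -- `k` between `V(1−η)` and `V`
  have hkV : (k : ℝ) ≤ V := by
    refine (Nat.floor_le (by positivity)).trans ?_
    rw [div_le_iff₀ (by positivity)]; nlinarith
  have hklow : V * (1 - η) ≤ k := by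
    have h1 : V / (1 + η) - 1 ≤ k := by
      have := Nat.lt_floor_add_one (V / (1 + η))
      show V / (1 + η) - 1 ≤ ((⌊V / (1 + η)⌋₊ : ℕ) : ℝ)
      linarith
    have h2 : V * (1 - η) ≤ V / (1 + η) - 1 := by
      rw [le_sub_iff_add_le, le_div_iff₀ (by positivity)]
      -- `V(1−η)(1+η) + (1+η) ≤ V` iff `(1+η) ≤ V η²`, i.e. `(log V)²(1+η) ≤ V`
      have hlog2V : Real.log V ^ 2 * (1 + η) ≤ V := by
        have : Real.sqrt V ≤ V / 2 := by
          rw [Real.sqrt_le_left (by positivity)]; nlinarith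
        nlinarith
      have hηlog : η * Real.log V = 1 := by
        show 1 / Real.log V * Real.log V = 1
        field_simp
      have h3 : η ^ 2 * (Real.log V ^ 2 * (1 + η)) ≤ η ^ 2 * V :=
        mul_le_mul_of_nonneg_left hlog2V (sq_nonneg η)
      have h4 : η ^ 2 * (Real.log V ^ 2 * (1 + η)) = 1 + η := by
        rw [show η ^ 2 * (Real.log V ^ 2 * (1 + η)) = (η * Real.log V) ^ 2 * (1 + η) by ring, hηlog]
        ring
      nlinarith [h3, h4]
    linarith
  have hk0 : (0 : ℝ) < k := by
    have : (0 : ℝ) < V * (1 - η) := by nlinarith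
    linarith
  refine ⟨hklow, hkV, ?_⟩
  -- the bracket is `≤ −log(V/b) + 2 log log V ≤ 0`
  have hηV : η * V = V / Real.log V := by show 1 / Real.log V * V = V / Real.log V; ring
  have hbr : Real.log (k * b) - 2 * Real.log (η * V) ≤ -Real.log (V / b) + 2 * Real.log (Real.log V) := by
    have h1 : Real.log (k * b) ≤ Real.log (V * b) := Real.log_le_log (by positivity) (by nlinarith)
    rw [Real.log_mul hV0.ne' hb0.ne'] at h1
    rw [hηV, Real.log_div hV0.ne' (by linarith), Real.log_div hV0.ne' hb0.ne']
    linarith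
  have hneg : -Real.log (V / b) + 2 * Real.log (Real.log V) ≤ 0 := by
    -- `(log V)² ≤ √V ≤ V/b`
    have h1 : Real.log (Real.log V ^ 2) ≤ Real.log (V / b) :=
      Real.log_le_log (by positivity) (hlogV2.trans hsqV)
    rw [Real.log_pow] at h1
    push_cast at h1
    linarith
  -- multiply
  calc (k : ℝ) * (Real.log (k * b) - 2 * Real.log (η * V))
      ≤ (k : ℝ) * (-Real.log (V / b) + 2 * Real.log (Real.log V)) :=
        mul_le_mul_of_nonneg_left hbr hk0.le
    _ ≤ V * (1 - η) * (-Real.log (V / b) + 2 * Real.log (Real.log V)) :=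
        mul_le_mul_of_nonpos_right hklow hneg
    _ = -V * Real.log (V / b) + 2 * V * Real.log (Real.log V)
          + η * V * (Real.log (V / b) - 2 * Real.log (Real.log V)) := by ring
    _ ≤ -V * Real.log (V / b) + 2 * V * Real.log (Real.log V) + V := by
        have h1 : Real.log (V / b) - 2 * Real.log (Real.log V) ≤ Real.log V := by
          rw [Real.log_div hV0.ne' hb0.ne']
          have : 0 ≤ Real.log b := Real.log_nonneg (by linarith)
          have : 0 ≤ Real.log (Real.log V) := Real.log_nonneg (by linarith)
          linarith
        have h2 : η * V * (Real.log (V / b) - 2 * Real.log (Real.log V)) ≤ η * V * Real.log V :=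
          mul_le_mul_of_nonneg_left h1 (by positivity)
        have h3 : η * V * Real.log V = V := by
          show 1 / Real.log V * V * Real.log V = V
          field_simp
        linarith

/-- `Re(p^{−it}) = cos(t log p)` for a positive natural `p`. [folklore] -/
theorem re_natCast_cpow_neg_mul_I {p : ℕ} (hp : 0 < p) (t : ℝ) :
    (((p : ℂ)) ^ (-((t : ℂ) * I))).re = Real.cos (t * Real.log p) := by
  rw [Complex.cpow_def_of_ne_zero (Nat.cast_ne_zero.2 hp.ne'), ← Complex.natCast_log,
    show (Real.log p : ℂ) * -((t : ℂ) * I) = ((-(t * Real.log p) : ℝ) : ℂ) * I by push_cast; ring,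
    Complex.exp_ofReal_mul_I_re, Real.cos_neg]

/-- The eventual conditions in `V` (for `V → ∞`) used in the proof of Prop. 17. [folklore] -/
theorem eventually_conditions_V (C : ℝ) :
    ∀ᶠ V : ℝ in atTop, 2 ≤ Real.log V ∧ Real.log V ^ 2 ≤ Real.sqrt V ∧ 12 * C * Real.log V ≤ Real.sqrt V := by
  have hlog : Tendsto Real.log atTop atTop := Real.tendsto_log_atTop
  have h1 : ∀ᶠ V : ℝ in atTop, 2 ≤ Real.log V := hlog.eventually_ge_atTop 2
  have h0 : ∀ᶠ V : ℝ in atTop, 1 ≤ V := eventually_ge_atTop 1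
  -- `log V ≤ V^{1/4}` eventually, whence `(log V)² ≤ √V`
  have h2 : ∀ᶠ V : ℝ in atTop, Real.log V ^ 2 ≤ Real.sqrt V := by
    have ho := (isLittleO_log_rpow_atTop (by norm_num : (0 : ℝ) < 1 / 4)).bound (by norm_num : (0 : ℝ) < 1)
    filter_upwards [ho, h0, h1] with V hV hV1 hV2
    rw [Real.norm_eq_abs, Real.norm_eq_abs, abs_of_pos (by linarith : 0 < Real.log V), one_mul,
      abs_of_nonneg (by positivity)] at hV
    have hq : (V ^ (1 / 4 : ℝ)) ^ 2 = Real.sqrt V := by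
      rw [← Real.rpow_natCast, ← Real.rpow_mul (by linarith), Real.sqrt_eq_rpow]; norm_num
    rw [← hq]
    exact pow_le_pow_left₀ (by linarith) hV 2
  have h3 : ∀ᶠ V : ℝ in atTop, 12 * C * Real.log V ≤ Real.sqrt V := by
    have ho := (isLittleO_log_rpow_atTop (by norm_num : (0 : ℝ) < 1 / 2)).bound
      (by positivity : (0 : ℝ) < 1 / (12 * |C| + 1))
    filter_upwards [ho, h0, h1] with V hV hV1 hV2
    have hV' : Real.log V ≤ 1 / (12 * |C| + 1) * Real.sqrt V := by
      rw [Real.norm_eq_abs, Real.norm_eq_abs] at hV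
      have h' : ‖V ^ (1 / 2 : ℝ)‖ = Real.sqrt V := by
        rw [Real.norm_eq_abs, ← Real.sqrt_eq_rpow, abs_of_nonneg (Real.sqrt_nonneg V)]
      rw [← Real.norm_eq_abs (V ^ (1 / 2 : ℝ)), h'] at hV
      exact (le_abs_self _).trans hV
    have hC : 12 * C ≤ 12 * |C| + 1 := by linarith [le_abs_self C]
    have hlog0 : 0 ≤ Real.log V := by linarith
    calc 12 * C * Real.log V ≤ (12 * |C| + 1) * Real.log V := by gcongr
      _ ≤ (12 * |C| + 1) * (1 / (12 * |C| + 1) * Real.sqrt V) := by gcongr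
      _ = Real.sqrt V := by field_simp
  filter_upwards [h1, h2, h3] with V a1 a2 a3
  exact ⟨a1, a2, a3⟩

/-- The eventual conditions in `a = log T` used in the proof of Prop. 17. [folklore] -/
theorem eventually_conditions_a (V₀ : ℝ) :
    ∀ᶠ a : ℝ in atTop, 4 ≤ a ∧ 13 ≤ Real.log a ∧ V₀ ≤ Real.log a ^ 2 ∧ 24 * Real.log a ≤ a := by
  have hlog : Tendsto Real.log atTop atTop := Real.tendsto_log_atTop
  have h1 : ∀ᶠ a : ℝ in atTop, 4 ≤ a := eventually_ge_atTop 4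
  have h2 : ∀ᶠ a : ℝ in atTop, 13 ≤ Real.log a := hlog.eventually_ge_atTop 13
  have h3 : ∀ᶠ a : ℝ in atTop, V₀ ≤ Real.log a ^ 2 :=
    (hlog.eventually_ge_atTop (max V₀ 1)).mono fun a ha ↦ by
      have h1 : 1 ≤ Real.log a := (le_max_right _ _).trans ha
      calc V₀ ≤ Real.log a := (le_max_left _ _).trans ha
        _ ≤ Real.log a ^ 2 := by nlinarith
  have h4 : ∀ᶠ a : ℝ in atTop, 24 * Real.log a ≤ a := by
    have ho := Real.isLittleO_log_id_atTop.bound (by norm_num : (0 : ℝ) < 1 / 24)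
    filter_upwards [ho, h1] with a ha ha1
    rw [Real.norm_eq_abs, Real.norm_eq_abs, id, abs_of_pos (by linarith : (0 : ℝ) < a),
      abs_of_pos (Real.log_pos (by linarith))] at ha
    linarith
  filter_upwards [h1, h2, h3, h4] with a a1 a2 a3 a4
  exact ⟨a1, a2, a3, a4⟩

end DeviationFrequency

open DeviationFrequency PrimePolyMoments in
/-- **Balazard–de Roton 2008, Prop. 17, under RH** (frequency of large deviations of the zero
count), case `0 < h ≤ 1`, with `O(V) = 8V`: there is `T₀` such that for `T ≥ T₀`, `0 < h ≤ 1`,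
`(log log T)² ≤ V ≤ log T/log log T`, and every finite set `𝒯 ⊂ [T − 1, 2T + 1]` of reals pairwise
`≥ 1` apart with `N(t+h) − N(t−h) − (h/π) log(t/2π) ≥ V` for all `t ∈ 𝒯`,
`#𝒯 ≤ T exp(−V log(V/log log T) + 2V log log V + 8V)`. [cite: BalazardDeRoton2008, Prop. 17] -/
theorem card_deviations_le_of_RH (hRH : RiemannHypothesis) :
    ∃ T₀ : ℝ, ∀ T : ℝ, T₀ ≤ T → ∀ h : ℝ, 0 < h → h ≤ 1 → ∀ V : ℝ,
      Real.log (Real.log T) ^ 2 ≤ V → V ≤ Real.log T / Real.log (Real.log T) →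
      ∀ 𝒯 : Finset ℝ, (∀ t ∈ 𝒯, T - 1 ≤ t ∧ t ≤ 2 * T + 1) →
      (∀ t ∈ 𝒯, ∀ t' ∈ 𝒯, t ≠ t' → 1 ≤ |t - t'|) →
      (∀ t ∈ 𝒯, V ≤ ((zetaZeroCount (t + h) : ℝ) - zetaZeroCount (t - h)) - h / π * Real.log (t / (2 * π))) →
      (𝒯.card : ℝ) ≤ T * Real.exp (-V * Real.log (V / Real.log (Real.log T)) +
        2 * V * Real.log (Real.log V) + 8 * V) := by
  obtain ⟨C_F, hCF⟩ := ShortIntervalsRH.zetaZeroCount_short_interval_le_of_RH hRH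
  obtain ⟨V₀, hV₀⟩ := Filter.eventually_atTop.1 (eventually_conditions_V |C_F|)
  obtain ⟨a₀, ha₀⟩ := Filter.eventually_atTop.1 (eventually_conditions_a V₀)
  refine ⟨Real.exp a₀, fun T hT h hh0 hh1 V hVl hVu 𝒯 h𝒯 hsep hdev ↦ ?_⟩
  -- notation `a = log T`, `b = log log T`
  have hT0 : 0 < T := (Real.exp_pos a₀).trans_le hT
  set a : ℝ := Real.log T with ha
  have haa₀ : a₀ ≤ a := by rw [ha, ← Real.log_exp a₀]; exact Real.log_le_log (Real.exp_pos _) hT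
  obtain ⟨ha4, hb13, hbV₀, h24⟩ := ha₀ a haa₀
  set b : ℝ := Real.log a with hb
  have hb0 : 0 < b := by linarith only [hb13]
  have ha0 : 0 < a := by linarith only [ha4]
  have hTa : Real.exp a = T := by rw [ha, Real.exp_log hT0]
  have haT : a + 1 ≤ T := by rw [← hTa]; exact Real.add_one_le_exp a
  have hT1 : 1 ≤ T := by linarith only [haT, ha4]
  have hπ3 := Real.pi_gt_three
  have hπ4 := Real.pi_lt_four
  have hπ315 : π < 3.15 := Real.pi_lt_d2
  -- `V ≥ b² ≥ V₀`: the `V`-conditions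
  have hbbV : b ^ 2 ≤ V := hVl
  obtain ⟨hlogV2, hlogVsq, hCV⟩ := hV₀ V (hbV₀.trans hbbV)
  have hV169 : (169 : ℝ) ≤ V := by nlinarith only [hb13, hbbV]
  have hV0 : 0 < V := by linarith only [hV169]
  have hVa : V ≤ a / b := hVu
  have hVa' : V ≤ a := by
    refine hVa.trans ?_
    rw [div_le_iff₀ hb0]; nlinarith only [hb13, ha0]
  have hlogVb : Real.log V ≤ b := by rw [hb]; exact Real.log_le_log hV0 hVa'
  have hbsV : b ≤ Real.sqrt V := by rw [Real.le_sqrt hb0.le hV0.le]; exact hbbV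
  -- `η`, `k`, `Δ`
  set η : ℝ := 1 / Real.log V with hη
  have hη0 : 0 < η := by positivity
  have hη1 : η ≤ 1 / 2 := by
    rw [hη, div_le_div_iff₀ (by linarith only [hlogV2]) (by norm_num)]; linarith only [hlogV2]
  obtain ⟨hklow, hkV, h14⟩ := prop14 (by linarith only [hb13]) hbbV hlogV2 hlogVsq
  set k : ℕ := ⌊V / (1 + η)⌋₊ with hk
  have hk0 : (0 : ℝ) < k := by
    have : (0 : ℝ) < V * (1 - η) := by nlinarith only [hV0, hη1]
    linarith only [this, hklow]
  have hkle : (k : ℝ) * (1 + η) ≤ V := by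
    have := Nat.floor_le (show 0 ≤ V / (1 + η) by positivity)
    rw [← hk] at this
    rwa [le_div_iff₀ (by positivity)] at this
  set Δ : ℝ := (1 + η) * a / (2 * π * V) with hΔ
  have hΔ0 : 0 < Δ := by positivity
  have hΔ2 : 2 ≤ Δ := by
    -- `Δ ≥ a/(2πV) ≥ b/(2π) ≥ 2`
    rw [hΔ, le_div_iff₀ (by positivity)]
    have h1 : V * b ≤ a := by rwa [le_div_iff₀ hb0] at hVa
    calc 2 * (2 * π * V) ≤ 13 * V := by nlinarith only [hπ315, hV0]
      _ ≤ V * b := by nlinarith only [hb13, hV0]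
      _ ≤ a := h1
      _ ≤ (1 + η) * a := by nlinarith only [hη0, ha0]
  have hΔ1 : 1 ≤ Δ := by linarith only [hΔ2]
  have h2πΔ : 2 * π * Δ = (1 + η) * a / V := by
    rw [hΔ]; field_simp
  have hπΔa2 : π * Δ ≤ a / 2 := by
    have : π * Δ = (1 + η) * a / (2 * V) := by rw [hΔ]; field_simp
    rw [this, div_le_div_iff₀ (by positivity) (by norm_num)]
    nlinarith only [hη1, hV169, ha0]
  have hπΔa : π * Δ ≤ a := by linarith only [hπΔa2, ha0]
  have hexpπΔ : Real.exp (π * Δ) ≤ T - 1 := by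
    -- `exp(πΔ) ≤ exp(a/2) = √T ≤ T − 1`
    set r : ℝ := Real.exp (a / 2) with hr
    have hrT : r * r = T := by rw [hr, ← Real.exp_add, add_halves, hTa]
    have hr2 : 3 ≤ r := by
      have : (3 : ℝ) ≤ a / 2 + 1 := by linarith only [ha4]
      exact this.trans (Real.add_one_le_exp _)
    calc Real.exp (π * Δ) ≤ r := Real.exp_le_exp.2 hπΔa2
      _ ≤ r * r - 1 := by nlinarith only [hr2]
      _ = T - 1 := by rw [hrT]
  have hΔa : Δ ≤ a := by nlinarith only [hπΔa, hπ3, hΔ0]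
  have hlogΔ : Real.log Δ ≤ b := by rw [hb]; exact Real.log_le_log hΔ0 hΔa
  have hlogΔ0 : 0 ≤ Real.log Δ := Real.log_nonneg hΔ1
  -- the prime set and the coefficients
  set N : ℕ := ⌊Real.exp (2 * π * Δ)⌋₊ with hN
  set P : Finset ℕ := (Finset.Ioc 0 N).filter Nat.Prime with hP
  have hPprime : ∀ p ∈ P, p.Prime := fun p hp ↦ (Finset.mem_filter.1 hp).2
  have hPN : ∀ p ∈ P, p ≤ N := fun p hp ↦ (Finset.mem_Ioc.1 (Finset.mem_filter.1 hp).1).2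
  have hN1 : 1 ≤ N := by
    rw [hN]; refine Nat.le_floor ?_
    have : (1 : ℝ) ≤ Real.exp (2 * π * Δ) := Real.one_le_exp (by positivity)
    exact_mod_cast this
  set w : ℕ → ℝ := fun p ↦ (𝓕 (fun x : ℝ ↦ selbergMajorant Δ (-h) h x) (Real.log p / (2 * π))).re with hw
  set c : ℕ → ℝ := fun p ↦ 1 / π * (Real.log p / Real.sqrt p) * w p with hc
  have hc_bound : ∀ p ∈ P, c p ^ 2 ≤ 16 * (1 / p) := by
    intro p hp
    have hp2 : 2 ≤ p := (hPprime p hp).two_le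
    have hp0 : (0 : ℝ) < p := by exact_mod_cast (hPprime p hp).pos
    have h4 := abs_log_mul_re_fourier_selbergMajorant_le hΔ0 hh0.le hp2
    have hcp : |c p| ≤ 4 * (1 / Real.sqrt p) := by
      have : c p = (1 / Real.sqrt p) * (Real.log p / π * w p) := by rw [hc]; field_simp
      rw [this, abs_mul, abs_of_pos (by positivity), mul_comm]
      exact mul_le_mul_of_nonneg_right h4 (by positivity)
    calc c p ^ 2 = |c p| ^ 2 := (sq_abs _).symm
      _ ≤ (4 * (1 / Real.sqrt p)) ^ 2 := pow_le_pow_left₀ (abs_nonneg _) hcp 2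
      _ = 16 * (1 / p) := by
          rw [mul_pow, div_pow, one_pow, Real.sq_sqrt hp0.le]; norm_num
  have hcsum : ∑ p ∈ P, ‖(c p : ℂ)‖ ^ 2 ≤ 32 * b := by
    calc ∑ p ∈ P, ‖(c p : ℂ)‖ ^ 2 = ∑ p ∈ P, c p ^ 2 := by
          refine Finset.sum_congr rfl fun p _ ↦ ?_
          rw [Complex.norm_real, Real.norm_eq_abs, sq_abs]
      _ ≤ ∑ p ∈ P, 16 * (1 / (p : ℝ)) := Finset.sum_le_sum hc_bound
      _ = 16 * ∑ p ∈ P, (1 / (p : ℝ)) := by rw [Finset.mul_sum]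
      _ ≤ 16 * (Real.log Δ + Real.log (2 * π) + 4) := by
          gcongr; exact ShortIntervalsRH.sum_inv_prime_le_log Δ hΔ1
      _ ≤ 32 * b := by
          have : Real.log (2 * π) ≤ 2 * π - 1 := Real.log_le_sub_one_of_pos (by positivity)
          nlinarith only [this, hlogΔ, hb13, hπ4]
  -- the lower bound `‖P(t)‖ ≥ ηV/2` at the deviation points
  set U : ℝ := η * V / 2 with hU
  have hU0 : 0 < U := by positivity
  have hlow : ∀ t ∈ 𝒯, U ≤ ‖∑ p ∈ P, (c p : ℂ) * (p : ℂ) ^ (-((t : ℂ) * I))‖ := by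
    intro t ht
    obtain ⟨htT, ht2T⟩ := h𝒯 t ht
    have ht4 : 4 ≤ t := by linarith only [haT, htT, ha4]
    have ht0 : 0 < t := by linarith only [ht4]
    have h15 := hCF t Δ h ht4 hΔ2 (hexpπΔ.trans htT) hh0 hh1
    have hhπ : 2 * h * Real.log (t / (2 * π)) / (2 * π) = h / π * Real.log (t / (2 * π)) := by
      field_simp
    rw [hhπ, ← hN, ← hP] at h15
    set Ssum : ℝ := ∑ p ∈ P, Real.log p / Real.sqrt p *
      (𝓕 (fun x : ℝ ↦ selbergMajorant Δ (-h) h x) (Real.log p / (2 * π))).re * Real.cos (t * Real.log p)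
      with hSs
    have hd := hdev t ht
    -- the real part of the polynomial is the sum in Prop. 15
    have hre : (∑ p ∈ P, (c p : ℂ) * (p : ℂ) ^ (-((t : ℂ) * I))).re = (1 / π) * Ssum := by
      rw [hSs, Complex.re_sum, Finset.mul_sum]
      refine Finset.sum_congr rfl fun p hp ↦ ?_
      rw [Complex.re_ofReal_mul, re_natCast_cpow_neg_mul_I (hPprime p hp).pos, hc, hw]
      ring
    -- `log t/(2πΔ) ≤ V/(1+η) + 2V/a`
    have hlogt : Real.log t ≤ a + 2 := by
      have h2 : Real.log t ≤ Real.log (3 * T) := Real.log_le_log ht0 (by linarith only [ht2T, hT1])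
      rw [Real.log_mul (by norm_num) hT0.ne', ← ha] at h2
      have h9 : Real.log 3 ≤ 3 - 1 := Real.log_le_sub_one_of_pos (by norm_num)
      linarith only [h2, h9]
    have hmain : Real.log t / (2 * π * Δ) ≤ V / (1 + η) + 2 * V / a := by
      rw [h2πΔ, div_le_iff₀ (by positivity)]
      have h1 : (V / (1 + η) + 2 * V / a) * ((1 + η) * a / V) = a + 2 * (1 + η) := by
        field_simp
      rw [h1]
      nlinarith only [hlogt, hη0]
    -- `C_F log Δ ≤ |C_F| b`
    have hClog : C_F * Real.log Δ ≤ |C_F| * b := by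
      calc C_F * Real.log Δ ≤ |C_F| * Real.log Δ := by gcongr; exact le_abs_self _
        _ ≤ |C_F| * b := by gcongr
    -- the margin: `V − V/(1+η) − 2V/a − |C_F| b ≥ ηV/2`
    have hmargin : U ≤ V - (V / (1 + η) + 2 * V / a) - |C_F| * b := by
      have h1 : V - V / (1 + η) = η * V / (1 + η) := by field_simp; ring
      have h2 : η * V / 2 + η * V / 6 ≤ η * V / (1 + η) := by
        rw [div_add_div _ _ (by norm_num) (by norm_num), div_le_div_iff₀ (by norm_num) (by positivity)]
        have hre : (η * V * 6 + 2 * (η * V)) * (1 + η) = η * V * (8 * (1 + η)) := by ring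
        rw [hre, show η * V * (2 * 6) = η * V * 12 by ring]
        exact mul_le_mul_of_nonneg_left (by linarith only [hη1]) (by positivity)
      -- `2V/a ≤ ηV/12` and `|C_F| b ≤ ηV/12`
      have h3 : 2 * V / a ≤ η * V / 12 := by
        rw [hη, div_le_div_iff₀ ha0 (by norm_num)]
        have : 24 * Real.log V ≤ a := (mul_le_mul_of_nonneg_left hlogVb (by norm_num)).trans h24
        calc 2 * V * 12 = 24 * V := by ring
          _ ≤ 1 / Real.log V * V * a := by
              rw [div_mul_eq_mul_div, one_mul, div_mul_eq_mul_div, le_div_iff₀ (by linarith only [hlogV2])]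
              nlinarith only [this, hV0]
      have h4 : |C_F| * b ≤ η * V / 12 := by
        -- `12 |C_F| b log V ≤ 12 |C_F| √V log V ≤ V`
        have h5 : 12 * |C_F| * Real.log V * Real.sqrt V ≤ Real.sqrt V * Real.sqrt V :=
          mul_le_mul_of_nonneg_right hCV (Real.sqrt_nonneg V)
        rw [Real.mul_self_sqrt hV0.le] at h5
        have h6 : |C_F| * b ≤ |C_F| * Real.sqrt V := mul_le_mul_of_nonneg_left hbsV (abs_nonneg _)
        have h7 : |C_F| * Real.sqrt V ≤ η * V / 12 := by
          rw [hη, le_div_iff₀ (by norm_num), show 1 / Real.log V * V = V / Real.log V by ring,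
            le_div_iff₀ (by linarith only [hlogV2])]
          linarith only [h5]
        exact h6.trans h7
      rw [hU]
      linarith only [h1, h2, h3, h4]
    have hS : U ≤ -((1 / π) * Ssum) := by
      linarith only [hmargin, h15, hd, hmain, hClog]
    calc U ≤ |(∑ p ∈ P, (c p : ℂ) * (p : ℂ) ^ (-((t : ℂ) * I))).re| := by
          rw [hre]; exact hS.trans (neg_le_abs _)
      _ ≤ ‖∑ p ∈ P, (c p : ℂ) * (p : ℂ) ^ (-((t : ℂ) * I))‖ := Complex.abs_re_le_norm _
  -- Prop. 13 with `T' = 3T`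
  have hNk : ((N ^ k : ℕ) : ℝ) ≤ 3 * T := by
    have hNle : (N : ℝ) ≤ Real.exp (2 * π * Δ) := Nat.floor_le (Real.exp_pos _).le
    have hN0 : (0 : ℝ) ≤ N := Nat.cast_nonneg _
    push_cast
    calc (N : ℝ) ^ k ≤ Real.exp (2 * π * Δ) ^ k := pow_le_pow_left₀ hN0 hNle k
      _ = Real.exp (k * (2 * π * Δ)) := by rw [← Real.exp_nat_mul]
      _ ≤ Real.exp a := by
          refine Real.exp_le_exp.2 ?_
          rw [h2πΔ]
          have : (k : ℝ) * ((1 + η) * a / V) = (k * (1 + η)) * a / V := by ring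
          rw [this, div_le_iff₀ hV0]
          nlinarith only [hkle, ha0]
      _ = T := hTa
      _ ≤ 3 * T := by linarith only [hT0]
  have h13 := sum_norm_primePoly_pow_le P hPprime hN1 hPN (fun p ↦ (c p : ℂ)) k
    (show (1 : ℝ) ≤ 3 * T by linarith only [hT1])
    hNk 𝒯 (fun t ht ↦ by
      obtain ⟨h1, h2⟩ := h𝒯 t ht
      rw [abs_of_pos (by linarith only [h1, haT, ha4])]; linarith only [h2, hT1]) hsep
  -- `#𝒯 · U^{2k} ≤ Σ ‖P(t)‖^{2k}`
  have hcount : (𝒯.card : ℝ) * U ^ (2 * k) ≤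
      ∑ t ∈ 𝒯, ‖∑ p ∈ P, (c p : ℂ) * (p : ℂ) ^ (-((t : ℂ) * I))‖ ^ (2 * k) := by
    have := Finset.card_nsmul_le_sum 𝒯 (fun t ↦ ‖∑ p ∈ P, (c p : ℂ) * (p : ℂ) ^ (-((t : ℂ) * I))‖ ^ (2 * k))
      (U ^ (2 * k)) (fun t ht ↦ pow_le_pow_left₀ hU0.le (hlow t ht) _)
    rwa [nsmul_eq_mul] at this
  -- combine: `#𝒯 U^{2k} ≤ 432 T log(6T) k! (32 b)^k`
  have hM : (𝒯.card : ℝ) * U ^ (2 * k) ≤ 432 * T * Real.log (6 * T) * (k.factorial * (32 * b) ^ k) := by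
    refine (hcount.trans h13).trans ?_
    have hlog6T : 0 ≤ Real.log (2 * (3 * T)) := Real.log_nonneg (by linarith only [hT1])
    rw [show (2 : ℝ) * (3 * T) = 6 * T by ring] at hlog6T ⊢
    have : (∑ p ∈ P, ‖(c p : ℂ)‖ ^ 2) ^ k ≤ (32 * b) ^ k :=
      pow_le_pow_left₀ (Finset.sum_nonneg fun p _ ↦ by positivity) hcsum k
    calc 144 * (3 * T) * Real.log (6 * T) * (k.factorial * (∑ p ∈ P, ‖(c p : ℂ)‖ ^ 2) ^ k)
        ≤ 144 * (3 * T) * Real.log (6 * T) * (k.factorial * (32 * b) ^ k) := by gcongr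
      _ = 432 * T * Real.log (6 * T) * (k.factorial * (32 * b) ^ k) := by ring
  -- the final estimate
  have hE1 : 432 * Real.log (6 * T) ≤ Real.exp (b + 7) := by
    have hlog6T : Real.log (6 * T) = Real.log 6 + a := by rw [Real.log_mul (by norm_num) hT0.ne', ha]
    have hl6 : Real.log 6 ≤ 6 - 1 := Real.log_le_sub_one_of_pos (by norm_num)
    have he7 : (1000 : ℝ) ≤ Real.exp 7 := by
      have h27 : (2.7 : ℝ) ≤ Real.exp 1 := by linarith [Real.exp_one_gt_d9]
      have : Real.exp 7 = Real.exp 1 ^ 7 := by rw [← Real.exp_nat_mul]; norm_num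
      rw [this]
      have h77 := pow_le_pow_left₀ (by norm_num : (0 : ℝ) ≤ 2.7) h27 7
      have : (1000 : ℝ) ≤ (2.7 : ℝ) ^ 7 := by norm_num
      linarith
    rw [Real.exp_add, hb, Real.exp_log ha0, hlog6T]
    have := mul_le_mul_of_nonneg_left he7 ha0.le
    linarith only [hl6, this, ha4]
  have hE2 : (k.factorial : ℝ) * (32 * b) ^ k ≤
      U ^ (2 * k) * Real.exp (-V * Real.log (V / b) + 2 * V * Real.log (Real.log V) + 6 * V) := by
    -- `k! (32b)^k / U^{2k} = k! (128 b/(ηV)²)^k ≤ (128 k b/(ηV)²)^k = exp(k log(128 k b/(ηV)²))`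
    have hUk : U ^ (2 * k) = ((η * V) ^ 2 / 4) ^ k := by
      rw [pow_mul, hU]; congr 1; ring
    have hηV0 : 0 < η * V := by positivity
    set x : ℝ := 128 * (k * b) / (η * V) ^ 2 with hx
    have hx0 : 0 < x := by positivity
    have hfac : (k.factorial : ℝ) ≤ (k : ℝ) ^ k := by exact_mod_cast Nat.factorial_le_pow k
    have hstep : (k.factorial : ℝ) * (32 * b) ^ k ≤ ((η * V) ^ 2 / 4) ^ k * x ^ k := by
      have heq : ((η * V) ^ 2 / 4) ^ k * x ^ k = (k : ℝ) ^ k * (32 * b) ^ k := by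
        rw [← mul_pow, ← mul_pow]
        congr 1
        rw [hx]; field_simp; ring
      rw [heq]
      exact mul_le_mul_of_nonneg_right hfac (by positivity)
    rw [hUk]
    refine hstep.trans (mul_le_mul_of_nonneg_left ?_ (by positivity))
    -- `x^k = exp(k log x)` and `k log x ≤ 5k + k(log(kb) − 2 log(ηV))`
    rw [← Real.exp_log (pow_pos hx0 k), Real.log_pow]
    refine Real.exp_le_exp.2 ?_
    have hlogx : Real.log x = Real.log 128 + (Real.log (k * b) - 2 * Real.log (η * V)) := by
      rw [hx, Real.log_div (by positivity) (by positivity), Real.log_mul (by norm_num) (by positivity),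
        Real.log_pow]; push_cast; ring
    have hl128 : Real.log 128 < 5 := by
      have := Real.log_two_lt_d9
      rw [show (128 : ℝ) = 2 ^ 7 by norm_num, Real.log_pow]; push_cast; linarith
    rw [hlogx, mul_add]
    have : (k : ℝ) * Real.log 128 ≤ 5 * V := by nlinarith only [hl128, hkV, hk0]
    linarith only [this, h14]
  have hE3 : Real.exp (b + 7) * Real.exp (-V * Real.log (V / b) + 2 * V * Real.log (Real.log V) + 6 * V) ≤
      Real.exp (-V * Real.log (V / Real.log (Real.log T)) + 2 * V * Real.log (Real.log V) + 8 * V) := by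
    rw [← Real.exp_add]
    refine Real.exp_le_exp.2 ?_
    have : b + 7 ≤ 2 * V := by nlinarith only [hb13, hbbV]
    linarith only [this]
  -- divide by `U^{2k}`
  have hUpos : 0 < U ^ (2 * k) := pow_pos hU0 _
  have hfin : (𝒯.card : ℝ) * U ^ (2 * k) ≤
      (T * Real.exp (-V * Real.log (V / Real.log (Real.log T)) + 2 * V * Real.log (Real.log V) + 8 * V)) *
        U ^ (2 * k) := by
    calc (𝒯.card : ℝ) * U ^ (2 * k) ≤ 432 * T * Real.log (6 * T) * (k.factorial * (32 * b) ^ k) := hM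
      _ = T * (432 * Real.log (6 * T)) * (k.factorial * (32 * b) ^ k) := by ring
      _ ≤ T * Real.exp (b + 7) *
            (U ^ (2 * k) * Real.exp (-V * Real.log (V / b) + 2 * V * Real.log (Real.log V) + 6 * V)) := by
          gcongr
      _ = T * (Real.exp (b + 7) * Real.exp (-V * Real.log (V / b) + 2 * V * Real.log (Real.log V) + 6 * V)) *
            U ^ (2 * k) := by ring
      _ ≤ T * Real.exp (-V * Real.log (V / Real.log (Real.log T)) + 2 * V * Real.log (Real.log V) + 8 * V) *
            U ^ (2 * k) := by gcongr
  exact le_of_mul_le_mul_right hfin hUpos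

end Literature.NumberTheory.LFunctions
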